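import Literature.NumberTheory.Transcendental.KZDirichletScaling
import Literature.NumberTheory.Transcendental.KZDirichletPeeling
import Literature.NumberTheory.Transcendental.KZCubeProducts
import HarnessLib

/-!
# The pure-Beta Gauss multiplication in the formal period ring, from ONE box ∼ simplex equivalence

Let `P = KZ.FormalPeriodRing` be the formal period ring of the Kontsevich–Zagier calculus
(`KZRulesAssociator.lean`: formal combinations of integral representations modulo the four moves,
`⟦c⟧ = KZ.toFormalPeriod c`, product = Fubini product). Fix `m ≥ 0` (`n = m + 1`) and a rational
`s > 0`. The pure-Beta form of Gauss's multiplication formula (Andrews–Askey–Roy 1999, Thm 1.5.2)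
reads `∏_{i<m} B((i+1)/(m+1), s) = (m+1)^{(m+1)s-1} ∏_{j<m} B(s, (j+1)s)`. We prove it INSIDE `P`,

  `∏_{i<m} ⟦β((i+1)/(m+1), s)⟧ = ⟦[pt, κ]⟧ · ∏_{j<m} ⟦β(s, (j+1)s)⟧`, `κ = (m+1)^{(m+1)s-1}`
  (`KZ.gaussMultiplication_toFormalPeriod`),

from ONE equivalence `R_box ∼ R_spx` between the cube Beta representation of the left-hand side and
the big-simplex representation `[S_m, ((∏ σ_i)(m+1-Σσ_i))^{s-1}]` — verbatim the instance `(m, s)`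
of route item `MultiplicationAccessible` of summit KontsevichZagierPeriods, taken as a HYPOTHESIS.
Chain (all representations PINNED by domain and integrand):

* box side (`KZ.cubeBetaRep_toFormalPeriod_eq_prod`, from `KZCubeProducts`): a cube Beta
  representation is a Fubini product of one-variable Beta representations,
  `⟦R_box⟧ = ∏ ⟦β(x_j, y_j)⟧`;
* simplex side (`KZ.bigSimplex_toFormalPeriod`): scaling `R_spx ∼ κ · D_m(s; s)`
  (`KZ.bigSimplex_equivalent_constMul_dirichlet`), `⟦κ · r⟧ = ⟦[pt, κ]⟧ ⟦r⟧`
  (`KZ.toFormalPeriod_of_constMul`: `[pt, κ] × r` is a relabelling of `κ · r`), and peeling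
  `D_m(s; c) ∼ D_{m-1}(s; c+s) × β(s, c)` down to `D_0 ∼ [pt, 1]` (`KZ.dirichletPeel_equivalent`,
  `KZ.dirichletZero_equivalent`): `⟦D_m(s; c)⟧ = ∏_{j<m} ⟦β(s, c + js)⟧`
  (`KZ.dirichletRep_toFormalPeriod_eq_prod`), at `c = s`.

Everything is proved; no `def`, no named fact.
-/

noncomputable section

open MeasureTheory Set

namespace Literature.NumberTheory.Transcendental

namespace KZ

variable {n : ℕ}

/-! ## Constants factor out in `P`: `⟦κ · r⟧ = ⟦[pt, κ]⟧ · ⟦r⟧` -/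

namespace IntegralRep

/-- **`[pt, a] × r` is a relabelling of `a · r`**: along `finCongr : Fin n ≃ Fin (0 + n)` the Fubini
product `(unit.constMul a).prod r` IS `(r.constMul a).reindex _` (equality of representations: same
domain `pt × σ`, integrand `(a · 1) ⊗ f = a f`, `IntegralRep.prod_integrand_eq`). [folklore] -/
theorem unit_constMul_prod_eq_reindex (a : ℝ) (ha : IsAlgebraic ℚ a) (r : IntegralRep n) :
    (unit.constMul a ha).prod r = (r.constMul a ha).reindex (finCongr (Nat.zero_add n).symm) := by
  have hcoord : ∀ (w : Fin (0 + n) → ℝ),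
      (fun j => w (Fin.natAdd 0 j)) = fun i => w (finCongr (Nat.zero_add n).symm i) := by
    intro w; funext j; simp
  refine ext' ?_ ?_
  · ext w
    simp only [prod_domain, mem_prodDomain, domain_constMul, unit_domain, mem_univ, true_and,
      reindex_domain, mem_setOf_eq, hcoord]
  · rw [prod_integrand_eq, reindex_integrand]
    funext w
    rw [prodFun_apply, integrand_constMul, integrand_constMul, unit_integrand, hcoord]
    simp

end IntegralRep

/-- **Constants factor out in the formal period ring**: `⟦a · r⟧ = ⟦[pt, a]⟧ · ⟦r⟧` for a real
algebraic constant `a` (`⟦[pt, a]⟧ ⟦r⟧ = ⟦[pt, a] × r⟧`, and `[pt, a] × r` is a coordinate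
relabelling of `a · r`, a change-of-variables move: `KZ.of_sub_of_reindex_mem_relations`).
[cite: KontsevichZagier2001, §1.2 rule (2)] -/
theorem toFormalPeriod_of_constMul (a : ℝ) (ha : IsAlgebraic ℚ a) (r : IntegralRep n) :
    toFormalPeriod (of (r.constMul a ha)) =
      toFormalPeriod (of (IntegralRep.unit.constMul a ha)) * toFormalPeriod (of r) := by
  rw [toFormalPeriod_of_mul_of, IntegralRep.unit_constMul_prod_eq_reindex]
  exact toFormalPeriod_eq_iff.mpr (of_sub_of_reindex_mem_relations _ _)

/-! ## Box side: a cube Beta representation is a product of Beta classes -/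

/-- **Cube Beta representations are products in `P`**: for positive rational data `(x, y)`, a
representation `r` pinned as `[(0,1)ᴺ, ∏_j t_j^{x_j-1}(1-t_j)^{y_j-1}]` and representations `β j`
pinned as `[(0,1), t^{x_j-1}(1-t)^{y_j-1}]` satisfy `⟦r⟧ = ∏_j ⟦β j⟧` (induction on `N`: peel the
first variable by `KZ.cubeBetaRep_succ_equivalent_prod`, the tail cube representation existing by
`KZ.exists_cubeBetaRep`; `N = 0` is `KZ.cubeBetaRep_zero_equivalent_unit`). Value identity:
`∫_{(0,1)ᴺ} ∏ = ∏_j B(x_j, y_j)` (Fubini). [cite: KontsevichZagier2001, §4.1] -/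
theorem cubeBetaRep_toFormalPeriod_eq_prod : ∀ {N : ℕ} (x y : Fin N → ℚ),
    (∀ j, 0 < x j ∧ 0 < y j) → ∀ (r : IntegralRep N) (β : Fin N → IntegralRep 1),
    r.domain = {t | ∀ j, t j ∈ Set.Ioo (0:ℝ) 1} →
    Set.EqOn r.integrand
      (fun t => ∏ j, (t j) ^ ((x j : ℝ) - 1) * (1 - t j) ^ ((y j : ℝ) - 1)) r.domain →
    (∀ j, (β j).domain = {t | t 0 ∈ Set.Ioo (0:ℝ) 1}) →
    (∀ j, Set.EqOn (β j).integrand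
      (fun t => (t 0) ^ ((x j : ℝ) - 1) * (1 - t 0) ^ ((y j : ℝ) - 1)) (β j).domain) →
    toFormalPeriod (of r) = ∏ j, toFormalPeriod (of (β j))
  | 0, x, y, _, r, β, hrd, hri, _, _ => by
    rw [Finset.univ_eq_empty, Finset.prod_empty, ← toFormalPeriod_of_unit]
    exact (cubeBetaRep_zero_equivalent_unit x y r hrd hri).toFormalPeriod_eq
  | N + 1, x, y, hpos, r, β, hrd, hri, hβd, hβi => by
    obtain ⟨r', hr'd, hr'i⟩ :=
      exists_cubeBetaRep (fun j => x j.succ) (fun j => y j.succ) (fun j => hpos j.succ)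
    have h := cubeBetaRep_succ_equivalent_prod x y r (β 0) r' hrd hri (hβd 0) (hβi 0) hr'd hr'i
    rw [h.toFormalPeriod_eq, ← toFormalPeriod_of_mul_of,
      cubeBetaRep_toFormalPeriod_eq_prod (fun j => x j.succ) (fun j => y j.succ)
        (fun j => hpos j.succ) r' (fun j => β j.succ) hr'd hr'i (fun j => hβd j.succ)
        (fun j => hβi j.succ),
      Fin.prod_univ_succ]

/-! ## Simplex side: Dirichlet's representation peeled onto Beta classes -/

/-- **Dirichlet's representation is a product of Beta classes in `P`**: for rational `s, c > 0`, a
representation `D` pinned as `D_m(s; c) = [Δ_m, (∏ u_i^{s-1})(1 - Σ u_i)^{c-1}]` and representations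
`β j` pinned as `β(s, b_j) = [(0,1), t^{s-1}(1-t)^{b_j-1}]` with `b_j = c + j s` satisfy
`⟦D⟧ = ∏_{j<m} ⟦β j⟧` (induction on `m`: ONE peeling `D_{m+1}(s; c) ∼ D_m(s; c+s) × β(s, c)`,
`KZ.dirichletPeel_equivalent`, the smaller Dirichlet representation existing by
`KZ.exists_dirichletRep`; `D_0(s; c) ∼ [pt, 1]`, `KZ.dirichletZero_equivalent`). Value identity:
`Γ(s)^m Γ(c)/Γ(ms + c) = ∏_{j<m} B(s, c + js)`. [cite: AndrewsAskeyRoy1999, Thm 1.8.1] -/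
theorem dirichletRep_toFormalPeriod_eq_prod (s : ℚ) (hs : 0 < s) : ∀ (m : ℕ) (c : ℚ), 0 < c →
    ∀ (D : IntegralRep m) (b : Fin m → ℚ) (β : Fin m → IntegralRep 1),
    D.domain = {u | (∀ i, 0 < u i) ∧ ∑ i, u i < 1} →
    Set.EqOn D.integrand
      (fun u => (∏ i, (u i) ^ ((s:ℝ) - 1)) * (1 - ∑ i, u i) ^ ((c:ℝ) - 1)) D.domain →
    (∀ j, b j = c + ((j : ℕ) : ℚ) * s) →
    (∀ j, (β j).domain = {t | t 0 ∈ Set.Ioo (0:ℝ) 1}) →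
    (∀ j, Set.EqOn (β j).integrand
      (fun t => (t 0) ^ ((s:ℝ) - 1) * (1 - t 0) ^ (((b j : ℚ) : ℝ) - 1)) (β j).domain) →
    toFormalPeriod (of D) = ∏ j, toFormalPeriod (of (β j))
  | 0, c, _, D, b, β, hDd, hDi, _, _, _ => by
    rw [Finset.univ_eq_empty, Finset.prod_empty, ← toFormalPeriod_of_unit]
    exact (dirichletZero_equivalent s c D IntegralRep.unit hDd hDi IntegralRep.unit_domain
      (fun _ _ => rfl)).toFormalPeriod_eq
  | m + 1, c, hc, D, b, β, hDd, hDi, hb, hβd, hβi => by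
    obtain ⟨D', hD'd, hD'i⟩ := exists_dirichletRep s hs m (c + s) (add_pos hc hs)
    have hb0 : b 0 = c := by rw [hb]; simp
    have hB : Set.EqOn (β 0).integrand
        (fun t => (t 0) ^ ((s:ℝ) - 1) * (1 - t 0) ^ ((c:ℝ) - 1)) (β 0).domain := by
      have h := hβi 0
      rwa [hb0] at h
    have h := dirichletPeel_equivalent s c D D' (β 0) hDd hDi hD'd (fun u _ => by rw [hD'i])
      (hβd 0) hB
    rw [h.toFormalPeriod_eq, ← toFormalPeriod_of_mul_of, Fin.prod_univ_succ, mul_comm,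
      dirichletRep_toFormalPeriod_eq_prod s hs m (c + s) (add_pos hc hs) D' (fun j => b j.succ)
        (fun j => β j.succ) hD'd (fun u _ => by rw [hD'i])
        (fun j => by rw [hb, Fin.val_succ]; push_cast; ring) (fun j => hβd j.succ)
        (fun j => hβi j.succ)]

/-- **The big simplex in `P`**: a representation `P` pinned as
`[S_m, ((∏ σ_i)(m+1 - Σσ_i))^{s-1}]`, `S_m = {σ > 0, Σσ < m+1}` (verbatim the simplex side of
`MultiplicationAccessible`) and representations `β j` pinned as `β(s, b_j)`, `b_j = (j+1) s`,
satisfy `⟦P⟧ = ⟦[pt, κ]⟧ · ∏_{j<m} ⟦β j⟧`, `κ = (m+1)^{(m+1)s-1}`: scaling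
`P ∼ κ · D_m(s; s)` (`KZ.bigSimplex_equivalent_constMul_dirichlet`, `KZ.exists_dirichletRep`),
`⟦κ · D⟧ = ⟦[pt, κ]⟧ ⟦D⟧` (`KZ.toFormalPeriod_of_constMul`) and peeling
(`KZ.dirichletRep_toFormalPeriod_eq_prod` at `c = s`). Value identity:
`∫_{S_m} = (m+1)^{(m+1)s-1} ∏_{j<m} B(s, (j+1)s) = (m+1)^{(m+1)s-1} Γ(s)^{m+1}/Γ((m+1)s)`.
[cite: AndrewsAskeyRoy1999, Thm 1.8.1] -/
theorem bigSimplex_toFormalPeriod (m : ℕ) (s : ℚ) (hs : 0 < s) (P : IntegralRep m)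
    (hPd : P.domain = {x | (∀ i, 0 < x i) ∧ ∑ i, x i < (m:ℝ) + 1})
    (hPi : Set.EqOn P.integrand
      (fun x => ((∏ i, x i) * ((m:ℝ) + 1 - ∑ i, x i)) ^ ((s:ℝ) - 1)) P.domain)
    (b : Fin m → ℚ) (hb : ∀ j, b j = (((j : ℕ) : ℚ) + 1) * s) (β : Fin m → IntegralRep 1)
    (hβd : ∀ j, (β j).domain = {t | t 0 ∈ Set.Ioo (0:ℝ) 1})
    (hβi : ∀ j, Set.EqOn (β j).integrand
      (fun t => (t 0) ^ ((s:ℝ) - 1) * (1 - t 0) ^ (((b j : ℚ) : ℝ) - 1)) (β j).domain)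
    (hκ : IsAlgebraic ℚ (((m:ℝ) + 1) ^ (((m:ℝ) + 1) * s - 1))) :
    toFormalPeriod (of P) =
      toFormalPeriod (of (IntegralRep.unit.constMul (((m:ℝ) + 1) ^ (((m:ℝ) + 1) * s - 1)) hκ)) *
        ∏ j, toFormalPeriod (of (β j)) := by
  obtain ⟨D, hDd, hDi⟩ := exists_dirichletRep s hs m s hs
  have hPD := bigSimplex_equivalent_constMul_dirichlet m s P D hPd hPi hDd
    (fun u _ => by rw [hDi]) hκ
  rw [hPD.toFormalPeriod_eq, toFormalPeriod_of_constMul,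
    dirichletRep_toFormalPeriod_eq_prod s hs m s hs D b β hDd (fun u _ => by rw [hDi])
      (fun j => by rw [hb]; ring) hβd hβi]

/-- **Any representation equivalent to the big simplex** (e.g. the cube side `R_box` of the
instance `(m, s)` of `MultiplicationAccessible`, once `R_box ∼ R_spx` is known) has formal period
`⟦R⟧ = ⟦[pt, κ]⟧ · ∏_{j<m} ⟦β(s, (j+1)s)⟧`, `κ = (m+1)^{(m+1)s-1}`
(`KZ.bigSimplex_toFormalPeriod` and `KZ.Equivalent.toFormalPeriod_eq`).
[cite: AndrewsAskeyRoy1999, Thm 1.8.1] -/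
theorem toFormalPeriod_eq_of_equivalent_bigSimplex {k : ℕ} (m : ℕ) (s : ℚ) (hs : 0 < s)
    (R : IntegralRep k) (P : IntegralRep m)
    (hPd : P.domain = {x | (∀ i, 0 < x i) ∧ ∑ i, x i < (m:ℝ) + 1})
    (hPi : Set.EqOn P.integrand
      (fun x => ((∏ i, x i) * ((m:ℝ) + 1 - ∑ i, x i)) ^ ((s:ℝ) - 1)) P.domain)
    (hRP : Equivalent R P)
    (b : Fin m → ℚ) (hb : ∀ j, b j = (((j : ℕ) : ℚ) + 1) * s) (β : Fin m → IntegralRep 1)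
    (hβd : ∀ j, (β j).domain = {t | t 0 ∈ Set.Ioo (0:ℝ) 1})
    (hβi : ∀ j, Set.EqOn (β j).integrand
      (fun t => (t 0) ^ ((s:ℝ) - 1) * (1 - t 0) ^ (((b j : ℚ) : ℝ) - 1)) (β j).domain)
    (hκ : IsAlgebraic ℚ (((m:ℝ) + 1) ^ (((m:ℝ) + 1) * s - 1))) :
    toFormalPeriod (of R) =
      toFormalPeriod (of (IntegralRep.unit.constMul (((m:ℝ) + 1) ^ (((m:ℝ) + 1) * s - 1)) hκ)) *
        ∏ j, toFormalPeriod (of (β j)) :=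
  hRP.toFormalPeriod_eq.trans (bigSimplex_toFormalPeriod m s hs P hPd hPi b hb β hβd hβi hκ)

/-! ## The Gauss multiplication in `P` -/

/-- **Pure-Beta Gauss multiplication in `P` from one box ∼ simplex equivalence.** Let `R` be
pinned as the cube Beta representation `[(0,1)^m, ∏_i t_i^{(i+1)/(m+1)-1}(1-t_i)^{s-1}]` and `P` as
the big simplex `[S_m, ((∏ σ_i)(m+1-Σσ_i))^{s-1}]` (verbatim the two sides of the instance `(m, s)`
of `MultiplicationAccessible`), and assume `R ∼ P`. Then for representations `βL i` pinned as
`β(x_i, s)`, `x_i = (i+1)/(m+1)`, and `βR j` pinned as `β(s, b_j)`, `b_j = (j+1)s`: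
`∏_i ⟦βL i⟧ = ⟦[pt, κ]⟧ · ∏_j ⟦βR j⟧`, `κ = (m+1)^{(m+1)s-1}` (box side
`KZ.cubeBetaRep_toFormalPeriod_eq_prod`, simplex side `KZ.bigSimplex_toFormalPeriod`). Value
identity: `∏_{i<m} B((i+1)/(m+1), s) = (m+1)^{(m+1)s-1} ∏_{j<m} B(s, (j+1)s)`, i.e. Gauss's
multiplication formula `∏_{k<n} Γ(s + k/n) = (2π)^{(n-1)/2} n^{1/2-ns} Γ(ns)` in Beta form.
[cite: AndrewsAskeyRoy1999, Thm 1.5.2] -/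
theorem gaussMultiplication_toFormalPeriod_of_equivalent (m : ℕ) (s : ℚ) (hs : 0 < s)
    (R P : IntegralRep m) (hRd : R.domain = {x | ∀ i, x i ∈ Set.Ioo (0:ℝ) 1})
    (hRi : Set.EqOn R.integrand (fun x => ∏ i : Fin m,
      (x i) ^ ((((i:ℕ):ℝ) + 1) / ((m:ℝ) + 1) - 1) * (1 - x i) ^ ((s:ℝ) - 1)) R.domain)
    (hPd : P.domain = {x | (∀ i, 0 < x i) ∧ ∑ i, x i < (m:ℝ) + 1})
    (hPi : Set.EqOn P.integrand
      (fun x => ((∏ i, x i) * ((m:ℝ) + 1 - ∑ i, x i)) ^ ((s:ℝ) - 1)) P.domain)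
    (hRP : Equivalent R P)
    (x : Fin m → ℚ) (hx : ∀ i, x i = (((i : ℕ) : ℚ) + 1) / ((m : ℚ) + 1))
    (βL : Fin m → IntegralRep 1) (hβLd : ∀ i, (βL i).domain = {t | t 0 ∈ Set.Ioo (0:ℝ) 1})
    (hβLi : ∀ i, Set.EqOn (βL i).integrand
      (fun t => (t 0) ^ (((x i : ℚ) : ℝ) - 1) * (1 - t 0) ^ ((s:ℝ) - 1)) (βL i).domain)
    (b : Fin m → ℚ) (hb : ∀ j, b j = (((j : ℕ) : ℚ) + 1) * s)
    (βR : Fin m → IntegralRep 1) (hβRd : ∀ j, (βR j).domain = {t | t 0 ∈ Set.Ioo (0:ℝ) 1})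
    (hβRi : ∀ j, Set.EqOn (βR j).integrand
      (fun t => (t 0) ^ ((s:ℝ) - 1) * (1 - t 0) ^ (((b j : ℚ) : ℝ) - 1)) (βR j).domain)
    (hκ : IsAlgebraic ℚ (((m:ℝ) + 1) ^ (((m:ℝ) + 1) * s - 1))) :
    ∏ i, toFormalPeriod (of (βL i)) =
      toFormalPeriod (of (IntegralRep.unit.constMul (((m:ℝ) + 1) ^ (((m:ℝ) + 1) * s - 1)) hκ)) *
        ∏ j, toFormalPeriod (of (βR j)) := by
  have hxR : ∀ i : Fin m, ((x i : ℚ) : ℝ) = (((i:ℕ):ℝ) + 1) / ((m:ℝ) + 1) := fun i => by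
    rw [hx]; push_cast; ring
  have hpos : ∀ i : Fin m, 0 < x i ∧ 0 < s := fun i => ⟨by rw [hx]; positivity, hs⟩
  have hRi' : Set.EqOn R.integrand (fun t => ∏ i : Fin m,
      (t i) ^ (((x i : ℚ) : ℝ) - 1) * (1 - t i) ^ ((((fun _ => s) i : ℚ) : ℝ) - 1)) R.domain := by
    intro t ht
    rw [hRi ht]
    exact Finset.prod_congr rfl fun i _ => by rw [hxR]
  rw [← cubeBetaRep_toFormalPeriod_eq_prod x (fun _ => s) hpos R βL hRd hRi' hβLd hβLi]
  exact toFormalPeriod_eq_of_equivalent_bigSimplex m s hs R P hPd hPi hRP b hb βR hβRd hβRi hκ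

/-- **Pure-Beta Gauss multiplication in `P` from the instance `(m, s)` of
`MultiplicationAccessible`.** Assume that every representation pinned as the cube Beta
representation
`[(0,1)^m, ∏_i t_i^{(i+1)/(m+1)-1}(1-t_i)^{s-1}]` is equivalent to every representation pinned as
the big simplex `[S_m, ((∏ σ_i)(m+1-Σσ_i))^{s-1}]` (hypothesis `hM`, verbatim the instance `(m, s)`
of route item `MultiplicationAccessible`; both representations EXIST: `KZ.exists_cubeBetaRep`,
`KZ.exists_bigSimplexRep`). Then for representations `βL i` pinned as `β(x_i, s)`,
`x_i = (i+1)/(m+1)`, and `βR j` pinned as `β(s, b_j)`, `b_j = (j+1)s`: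
`∏_{i<m} ⟦βL i⟧ = ⟦[pt, κ]⟧ · ∏_{j<m} ⟦βR j⟧` in `P`, `κ = (m+1)^{(m+1)s-1}` (real algebraic and
positive: `KZ.isAlgebraic_gaussMultConst`, `KZ.gaussMultConst_pos`). Value identity:
`∏_{i<m} B((i+1)/(m+1), s) = (m+1)^{(m+1)s-1} ∏_{j<m} B(s, (j+1)s)`.
[cite: AndrewsAskeyRoy1999, Thm 1.5.2] -/
theorem gaussMultiplication_toFormalPeriod (m : ℕ) (s : ℚ) (hs : 0 < s)
    (hM : ∀ (r r' : IntegralRep m), r.domain = {x | ∀ i, x i ∈ Set.Ioo (0:ℝ) 1} →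
      Set.EqOn r.integrand (fun x => ∏ i : Fin m,
        (x i) ^ ((((i:ℕ):ℝ) + 1) / ((m:ℝ) + 1) - 1) * (1 - x i) ^ ((s:ℝ) - 1)) r.domain →
      r'.domain = {x | (∀ i, 0 < x i) ∧ ∑ i, x i < (m:ℝ) + 1} →
      Set.EqOn r'.integrand
        (fun x => ((∏ i, x i) * ((m:ℝ) + 1 - ∑ i, x i)) ^ ((s:ℝ) - 1)) r'.domain →
      Equivalent r r')
    (x : Fin m → ℚ) (hx : ∀ i, x i = (((i : ℕ) : ℚ) + 1) / ((m : ℚ) + 1))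
    (βL : Fin m → IntegralRep 1) (hβLd : ∀ i, (βL i).domain = {t | t 0 ∈ Set.Ioo (0:ℝ) 1})
    (hβLi : ∀ i, Set.EqOn (βL i).integrand
      (fun t => (t 0) ^ (((x i : ℚ) : ℝ) - 1) * (1 - t 0) ^ ((s:ℝ) - 1)) (βL i).domain)
    (b : Fin m → ℚ) (hb : ∀ j, b j = (((j : ℕ) : ℚ) + 1) * s)
    (βR : Fin m → IntegralRep 1) (hβRd : ∀ j, (βR j).domain = {t | t 0 ∈ Set.Ioo (0:ℝ) 1})
    (hβRi : ∀ j, Set.EqOn (βR j).integrand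
      (fun t => (t 0) ^ ((s:ℝ) - 1) * (1 - t 0) ^ (((b j : ℚ) : ℝ) - 1)) (βR j).domain)
    (hκ : IsAlgebraic ℚ (((m:ℝ) + 1) ^ (((m:ℝ) + 1) * s - 1))) :
    ∏ i, toFormalPeriod (of (βL i)) =
      toFormalPeriod (of (IntegralRep.unit.constMul (((m:ℝ) + 1) ^ (((m:ℝ) + 1) * s - 1)) hκ)) *
        ∏ j, toFormalPeriod (of (βR j)) := by
  have hxR : ∀ i : Fin m, ((x i : ℚ) : ℝ) = (((i:ℕ):ℝ) + 1) / ((m:ℝ) + 1) := fun i => by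
    rw [hx]; push_cast; ring
  have hpos : ∀ i : Fin m, 0 < x i ∧ 0 < s := fun i => ⟨by rw [hx]; positivity, hs⟩
  -- the two sides of the instance exist
  obtain ⟨R, hRd, hRi⟩ := exists_cubeBetaRep x (fun _ => s) hpos
  obtain ⟨D, hDd, hDi⟩ := exists_dirichletRep s hs m s hs
  obtain ⟨P, hPd, hPi⟩ := exists_bigSimplexRep m s D hDd (fun u _ => by rw [hDi])
  have hRi' : Set.EqOn R.integrand (fun t => ∏ i : Fin m,
      (t i) ^ ((((i:ℕ):ℝ) + 1) / ((m:ℝ) + 1) - 1) * (1 - t i) ^ ((s:ℝ) - 1)) R.domain := by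
    intro t ht
    rw [hRi ht]
    exact Finset.prod_congr rfl fun i _ => by rw [hxR]
  exact gaussMultiplication_toFormalPeriod_of_equivalent m s hs R P hRd hRi' hPd
    (fun z _ => by rw [hPi]) (hM R P hRd hRi' hPd fun z _ => by rw [hPi]) x hx βL hβLd hβLi b hb
    βR hβRd hβRi hκ

end KZ

end Literature.NumberTheory.Transcendental
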